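import Summits.HodgeConjecture.HodgeConjecture.Theorems.SplitImpliesAllNonsplitCellsConnectedOfJ1
import Summits.HodgeConjecture.HodgeConjecture.Theorems.SplitImpliesAllSplitSixfoldCellsOfMarkman
import Summits.HodgeConjecture.HodgeConjecture.Theorems.Ring2AbelianAllWeilAnchorCellsOnPath
import HarnessLib

/-!
# Route `SplitImpliesAll` — EXACT REACH in the kernel: the leaf `WeilSixfolds` IS `K1 ∧ K2` modulo Deligne's period
  construction, and on EVERY Weil cell the cell's Hodge statement IS its variational-Hodge instance (vhodge seat P3)

SUPPORT file for item stmt-HodgeConjecture-19149 (`SplitImpliesAll.NonsplitSixfoldCells`, K1 — the route's one open mathematical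
statement). The two landed support files give the FORWARD price theorems
(`SplitImpliesAllNonsplitCellsConnectedOfJ1.weilSixfolds_of_J1_of_split_of_nonsplitVariational : J1 → K2 → K1 → WeilSixfolds`,
`SplitImpliesAllSplitSixfoldCellsOfMarkman.weilSixfolds_of_markman2025_of_nonsplitCells : Markman → K3 → K1 → WeilSixfolds`). This file
adds the CONVERSES and hence the EXACTNESS statements the seat's brief («exact reach») asks for, all as compositions of tree theorems:

* §1 (fact-free) the leaf implies both cell items: `WeilSixfolds → K1` (through ring 2's on-path lemma
  `weilVariationalHodgeComponent_of_weilClassesComponent`: a cell's variational instance is a CONSEQUENCE of the cell) and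
  `WeilSixfolds → K2`; so, granted K3 as a hypothesis, `WeilSixfolds ↔ K2 ∧ K1`.
* §2 (modulo J1 = `deligne1982_weilFamily_periodConstructionAtWeilType`, an UNPROVED named Literature fact used as a hypothesis) on
  EVERY cell `(ℚ(√-d), 2n, δ)`, `n, d ≥ 1`: `WeilClassesComponent n d δ ↔ WeilVariationalHodgeComponent n d δ` — the cell's case of
  Weil's question is EQUIVALENT to Grothendieck's variational Hodge conjecture on `(ℚ(√-d), 2n, δ)`-Weil families (⟸ is ring 2's
  anchor engine `weilClassesComponent_of_isogenyConnectedToCMAnchor_of_variational` fed the landed `isogenyConnectedToCMAnchor_of_J1`).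
* §3 the leaf's exact reach: `J1 → (WeilSixfolds ↔ K2 ∧ K1)`, `J1 → Markman → (WeilSixfolds ↔ K1)`, and
  `J1 → (WeilSixfolds ↔ ∀ d δ, WeilVariationalHodgeComponent 3 d δ)`.
* §4 the whole imaginary-quadratic Weil column: `J1 → (WeilClassesImaginaryQuadratic ↔ ∀ n ≥ 2, d, δ of sign (-1)ⁿ,
  WeilVariationalHodgeComponent n d δ)` — Weil's 1977 question over imaginary quadratic fields is, modulo Deligne's period
  construction, EXACTLY the variational Hodge conjecture on right-sign Weil families.

Every named fact (J1, Markman's preprint theorem) is a HYPOTHESIS; nothing is asserted; nothing here proves a case of the Hodge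
conjecture, and `HC_CM` occurs nowhere. [cite: vanGeemen1994HodgeAV, Lemma 5.2, 5.3–5.5] [cite: Deligne1982HodgeCycles, §4, proof of Thm. 4.8]
[cite: Markman2025SecantWeil, Thm. 1.5.1 (preprint, unrefereed)] [cite: CharlesSchnell2014Notes, Conj. 11.3.1] [cite: Weil1977HodgeRing]
-/

set_option linter.dupNamespace false

open Literature.AlgebraicGeometry.HodgeTheory
open Literature.AlgebraicGeometry.VanGeemen1994
open Summit.HodgeConjecture.HodgeConjecture.Ring2.Hypotheses
open Summit.HodgeConjecture.HodgeConjecture.Ring2.AbelianAll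
open Summit.HodgeConjecture.HodgeConjecture.Theorems.SplitImpliesAllNonsplitCellsConnectedOfJ1
open Summit.HodgeConjecture.HodgeConjecture.Theorems.SplitImpliesAllSplitSixfoldCellsOfMarkman

namespace Summit.HodgeConjecture.HodgeConjecture.Theorems.SplitImpliesAllExactReach

/-! ## §1 Fact-free: the leaf implies both cell items; granted K3 it is equivalent to their conjunction -/

/-- **`WeilSixfolds → K1`, fact-free**: the variational-Hodge instance of a non-split right-sign sixfold cell is a CONSEQUENCE of the
leaf (slice the leaf to the cell, then ring 2's on-path lemma: on a `δ`-Weil family every fibre class is read on its chart as a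
member's Weil class). [cite: vanGeemen1994HodgeAV, Lemma 5.2 (3)] -/
theorem nonsplitSixfoldCells_of_weilSixfolds
    (hW : Summit.HodgeConjecture.HodgeConjecture.Theses.SevenfoldWeilCensus.WeilSixfolds) :
    Summit.HodgeConjecture.HodgeConjecture.Theses.SplitImpliesAll.NonsplitSixfoldCells :=
  fun _ hd δ _ _ => weilVariationalHodgeComponent_of_weilClassesComponent (weilClassesComponent_three_of_weilSixfolds hW hd δ)

/-- **`WeilSixfolds → K2`, fact-free**: the split sixfold cells are slices of the leaf. [cite: vanGeemen1994HodgeAV, Lemma 5.2] -/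
theorem splitSixfoldCells_of_weilSixfolds
    (hW : Summit.HodgeConjecture.HodgeConjecture.Theses.SevenfoldWeilCensus.WeilSixfolds) :
    Summit.HodgeConjecture.HodgeConjecture.Theses.SplitImpliesAll.SplitSixfoldCells :=
  fun _ hd => weilClassesComponent_three_of_weilSixfolds hW hd _

/-- **Granted K3 (`NonsplitCellsConnected`, a hypothesis), the leaf IS `K2 ∧ K1`, fact-free**: ⟸ is the route's deciding theorem
`SplitImpliesAll.closes`, ⟹ is §1. [cite: vanGeemen1994HodgeAV, Lemma 5.2, 5.3–5.5] -/
theorem weilSixfolds_iff_cells_of_nonsplitCellsConnected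
    (hC : Summit.HodgeConjecture.HodgeConjecture.Theses.SplitImpliesAll.NonsplitCellsConnected) :
    Summit.HodgeConjecture.HodgeConjecture.Theses.SevenfoldWeilCensus.WeilSixfolds ↔
      (Summit.HodgeConjecture.HodgeConjecture.Theses.SplitImpliesAll.SplitSixfoldCells ∧
        Summit.HodgeConjecture.HodgeConjecture.Theses.SplitImpliesAll.NonsplitSixfoldCells) :=
  ⟨fun hW => ⟨splitSixfoldCells_of_weilSixfolds hW, nonsplitSixfoldCells_of_weilSixfolds hW⟩,
    fun h => Summit.HodgeConjecture.HodgeConjecture.Theses.SplitImpliesAll.closes h.1 h.2 hC⟩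

/-! ## §2 Modulo J1, on EVERY cell: the cell's Hodge statement IS its variational-Hodge instance -/

/-- **Cell exactness modulo Deligne's period construction**: for `n, d ≥ 1` and every discriminant class `δ`,
`WeilClassesComponent n d δ ↔ WeilVariationalHodgeComponent n d δ` granted J1 (hypothesis `hJ`, UNPROVED named fact). ⟹ is ring 2's
on-path lemma (fact-free); ⟸ is ring 2's anchor engine at the CM-tower anchor fed the landed N73-mod-J1 theorem
`isogenyConnectedToCMAnchor_of_J1`. So on each cell the ONLY thing between print and the cell's case of Weil's question is ONE
instance of Grothendieck's variational Hodge conjecture. [cite: Deligne1982HodgeCycles, §4, proof of Thm. 4.8]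
[cite: vanGeemen1994HodgeAV, Lemma 5.2, 5.3–5.5] [cite: CharlesSchnell2014Notes, Conj. 11.3.1] -/
theorem weilClassesComponent_iff_variational_of_J1 (hJ : deligne1982_weilFamily_periodConstructionAtWeilType)
    {n d : ℕ} (hn : 1 ≤ n) (hd : 0 < d) (δ : weilNormResidueGroup d) :
    WeilClassesComponent n d δ ↔ WeilVariationalHodgeComponent n d δ :=
  ⟨weilVariationalHodgeComponent_of_weilClassesComponent, fun hV =>
    weilClassesComponent_of_isogenyConnectedToCMAnchor_of_variational hd (isogenyConnectedToCMAnchor_of_J1 hJ hn hd δ) hV⟩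

/-! ## §3 The leaf's exact reach modulo print -/

/-- **EXACT REACH modulo J1**: `WeilSixfolds ↔ K2 ∧ K1` granted Deligne's period construction (K3 discharged by name through
`nonsplitCellsConnected_of_J1`). [cite: Deligne1982HodgeCycles, §4, proof of Thm. 4.8] [cite: vanGeemen1994HodgeAV, Lemma 5.2, 5.3–5.5] -/
theorem weilSixfolds_iff_cells_of_J1 (hJ : deligne1982_weilFamily_periodConstructionAtWeilType) :
    Summit.HodgeConjecture.HodgeConjecture.Theses.SevenfoldWeilCensus.WeilSixfolds ↔
      (Summit.HodgeConjecture.HodgeConjecture.Theses.SplitImpliesAll.SplitSixfoldCells ∧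
        Summit.HodgeConjecture.HodgeConjecture.Theses.SplitImpliesAll.NonsplitSixfoldCells) :=
  weilSixfolds_iff_cells_of_nonsplitCellsConnected (nonsplitCellsConnected_of_J1 hJ)

/-- **EXACT REACH modulo J1 and Markman's split theorem (preprint)**: the leaf `WeilSixfolds` (all rational `(3,3)` Weil classes on
all complex abelian sixfolds of Weil type over imaginary quadratic fields) is EQUIVALENT to the single open item K1
`NonsplitSixfoldCells`. Both inputs are hypotheses. [cite: Markman2025SecantWeil, Thm. 1.5.1 (preprint, unrefereed)]
[cite: Deligne1982HodgeCycles, §4, proof of Thm. 4.8] [cite: vanGeemen1994HodgeAV, Lemma 5.2, 5.3–5.5] -/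
theorem weilSixfolds_iff_nonsplitSixfoldCells_of_J1_of_markman2025
    (hJ : deligne1982_weilFamily_periodConstructionAtWeilType) (hM : Markman2025_weilClasses_algebraic_hyperbolicSixfold) :
    Summit.HodgeConjecture.HodgeConjecture.Theses.SevenfoldWeilCensus.WeilSixfolds ↔
      Summit.HodgeConjecture.HodgeConjecture.Theses.SplitImpliesAll.NonsplitSixfoldCells :=
  ⟨nonsplitSixfoldCells_of_weilSixfolds, fun hV =>
    weilSixfolds_of_J1_of_split_of_nonsplitVariational hJ (splitSixfoldCells_of_markman2025 hM) hV⟩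

/-- **The leaf IS the variational Hodge conjecture on `(ℚ(√-d), 6, δ)`-Weil families, modulo J1** (all `d > 0`, all `δ`).
[cite: Deligne1982HodgeCycles, §4, proof of Thm. 4.8] [cite: vanGeemen1994HodgeAV, Lemma 5.2, 5.3–5.5] -/
theorem weilSixfolds_iff_variationalComponents_of_J1 (hJ : deligne1982_weilFamily_periodConstructionAtWeilType) :
    Summit.HodgeConjecture.HodgeConjecture.Theses.SevenfoldWeilCensus.WeilSixfolds ↔
      ∀ d : ℕ, 0 < d → ∀ δ : weilNormResidueGroup d, WeilVariationalHodgeComponent 3 d δ :=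
  weilSixfolds_iff_components.trans
    ⟨fun h d hd δ => (weilClassesComponent_iff_variational_of_J1 hJ (by norm_num) hd δ).1 (h d hd δ),
      fun h d hd δ => (weilClassesComponent_iff_variational_of_J1 hJ (by norm_num) hd δ).2 (h d hd δ)⟩

/-- **The leaf IS the variational Hodge conjecture on the NEGATIVE-discriminant sixfold Weil families, modulo J1** (the
wrong-sign cells hold outright). [cite: vanGeemen1994HodgeAV, 4.14 and Lemma 5.2 (4)] [cite: Deligne1982HodgeCycles, §4] -/
theorem weilSixfolds_iff_negative_variationalComponents_of_J1 (hJ : deligne1982_weilFamily_periodConstructionAtWeilType) :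
    Summit.HodgeConjecture.HodgeConjecture.Theses.SevenfoldWeilCensus.WeilSixfolds ↔
      ∀ d : ℕ, 0 < d → ∀ δ : weilNormResidueGroup d, weilSign d δ = -1 → WeilVariationalHodgeComponent 3 d δ :=
  weilSixfolds_iff_negative_components.trans
    ⟨fun h d hd δ hs => (weilClassesComponent_iff_variational_of_J1 hJ (by norm_num) hd δ).1 (h d hd δ hs),
      fun h d hd δ hs => (weilClassesComponent_iff_variational_of_J1 hJ (by norm_num) hd δ).2 (h d hd δ hs)⟩

/-! ## §4 The whole imaginary-quadratic Weil column modulo J1 -/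

/-- **Weil's question by component IS the variational Hodge conjecture on Weil families, modulo J1** (every `n ≥ 2`, `d > 0`, `δ`).
[cite: Weil1977HodgeRing] [cite: vanGeemen1994HodgeAV, Lemma 5.2] [cite: Deligne1982HodgeCycles, §4, proof of Thm. 4.8] -/
theorem weilClassesByComponent_iff_variational_of_J1 (hJ : deligne1982_weilFamily_periodConstructionAtWeilType) :
    WeilClassesByComponent ↔
      ∀ n : ℕ, 2 ≤ n → ∀ d : ℕ, 0 < d → ∀ δ : weilNormResidueGroup d, WeilVariationalHodgeComponent n d δ :=
  ⟨fun h n hn d hd δ => (weilClassesComponent_iff_variational_of_J1 hJ (by omega) hd δ).1 (h n hn d hd δ),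
    fun h n hn d hd δ => (weilClassesComponent_iff_variational_of_J1 hJ (by omega) hd δ).2 (h n hn d hd δ)⟩

/-- **Weil's 1977 question over imaginary quadratic fields (R∞, `WeilClassesImaginaryQuadratic`) IS, modulo Deligne's period
construction, the variational Hodge conjecture on the RIGHT-SIGN Weil families `(ℚ(√-d), 2n, δ)`, `sign δ = (-1)ⁿ`** — the exact
class statement of the seat's brief for the whole column: granted J1, nothing but variational-Hodge instances separates print from R∞,
and each instance is necessary. [cite: Weil1977HodgeRing] [cite: vanGeemen1994HodgeAV, 4.14, Lemma 5.2, 5.3–5.5]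
[cite: Deligne1982HodgeCycles, §4, proof of Thm. 4.8] [cite: CharlesSchnell2014Notes, Conj. 11.3.1] -/
theorem weilClassesImaginaryQuadratic_iff_rightSign_variational_of_J1
    (hJ : deligne1982_weilFamily_periodConstructionAtWeilType) :
    Summit.HodgeConjecture.HodgeConjecture.WeilTypeLadder.WeilClassesImaginaryQuadratic ↔
      ∀ n : ℕ, 2 ≤ n → ∀ d : ℕ, 0 < d → ∀ δ : weilNormResidueGroup d, weilSign d δ = (-1) ^ n →
        WeilVariationalHodgeComponent n d δ :=
  weilClassesImaginaryQuadratic_iff_byComponent_holds.trans <| weilClassesByComponent_iff_sign.trans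
    ⟨fun h n hn d hd δ hs => (weilClassesComponent_iff_variational_of_J1 hJ (by omega) hd δ).1 (h n hn d hd δ hs),
      fun h n hn d hd δ hs => (weilClassesComponent_iff_variational_of_J1 hJ (by omega) hd δ).2 (h n hn d hd δ hs)⟩

end Summit.HodgeConjecture.HodgeConjecture.Theorems.SplitImpliesAllExactReach
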